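import Summits.CriticalPhenomena.PercolationContinuityZ3.Theorems.PercNearOneGluingNoHeavyLowerTailSunflowerCoverCalculus
import Summits.CriticalPhenomena.PercolationContinuityZ3.Theorems.PercNearOneGluingNoHeavyLowerTailSunflowerReadOnce

/-!
# `NoHeavyLowerTail` (crux stmt-CriticalPhenomena-4575), abstract sunflower cubic: EVERY READ-ONCE CORE IS GRADEDLY SAFE

Support file (seat `prim-ineq-prove-1` gen 36; `--supports stmt-CriticalPhenomena-4575`).  No `sorry`, no named facts.
Memo: run/shared/lean/prim/prim-ineq-prove-1/FINDING-COVER-prove1-g36.md §3–§4.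

This file discharges the read-once conjectures (RO) of gen 34 (memo FINDING-PRINCIPALCORE §9) and (GS-RO) of gen 35 (memo
FINDING-LSM §5–6): for EVERY well-formed monotone read-once formula `F : ROF ι` of `…SunflowerReadOnce` (leaves = principal
filters, disjoint-clause CNF leaves, `∧`/`∨` of sub-formulas on disjoint supports) and every product measure with positive coordinate
probabilities on the support:
* `ROF.exists_covFam` — the up-set `F.toSet` has a COVER FAMILY on its support (`SafeCalc.CovFam`; built by the cover calculus
  `covFam_leaf` / `covFam_and` / `covFam_or` of `…SunflowerCoverCalculus`);
* **`ROF.gsafe_of_wf`** — `F.toSet` is GRADEDLY SAFE on its support (`SafeCalc.gsafe_of_covFam`, i.e. THEOREM 1 `prod_BEx_le_of_cover`);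
* **`ROF.safe_of_wf`** — `F.toSet` is SAFE; hence (rows of `…SunflowerSafeCalculus`) Lemma A `μ(E₁)μ(E₂)μ(E₃) ≤ μ(A)²`
  (`ROF.lemmaA_of_wf`), the (C1-law) `e₃ ≤ max(a,b)(ab − e₂)` (`ROF.e3_le_max_mul_AG_of_wf`), the `H`-row (`ROF.lawH_nonneg_of_wf`)
  and Kahn's Conjecture 5 on the complements (`ROF.sahiE3_compl_nonneg_of_wf`) for every three-petal sunflower of up-sets whose core
  is ANY read-once up-set — in particular for the smallest instances left open by gens 34–35,
  `T = x₇ ∧ (x₁(x₂ ∨ x₃) ∨ x₄(x₅ ∨ x₆))` (`ROF.gsafe_T`) and `T ∨ T′`.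
The class-S′ hypothesis `ROF.InS` of `ROF.safe_of_inS` (gen 34) is thereby removed.
-/

noncomputable section

namespace Summit.CriticalPhenomena.PercolationContinuityZ3.Theorems.SunflowerPartition

open MeasureTheory Finset
open Literature.Probability.LatticeModels Literature.Probability.Percolation

variable {ι : Type*} [DecidableEq ι] (p : ι → unitInterval)

namespace SafeCalc

open TwoGenCore (wmiss)

/-! ## Base cases of the cover calculus: the sure event, principal filters, clauses, disjoint-clause CNFs -/

/-- Block expectation over the empty block. [this work] -/
theorem BEx_emptyBlock (F : Finset ι → ℝ) : BEx p ∅ F = F ∅ := by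
  unfold BEx TwoGenCore.wmiss
  rw [Finset.powerset_empty, sum_singleton]
  simp

/-- The sure event on the empty block has the (empty) cover family. [this work] -/
theorem covFam_univ {A : Set (Set ι)} (hA : ∀ ω, ω ∈ A) : CovFam p ∅ A ∅ := by
  have hfam : ∀ 𝒰 : Finset (Finset ι), famIn p ∅ ∅ 𝒰 = 1 := by
    intro 𝒰; unfold famIn; rw [BEx_emptyBlock, if_pos]; intro C hC; exact absurd hC (notMem_empty C)
  refine ⟨fun C hC => absurd hC (notMem_empty C), fun C hC => absurd hC (notMem_empty C),
    fun T _ hT => absurd (hA _) hT, fun K m S _ => ?_, by rw [hfam]; exact one_pos⟩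
  rw [prod_congr rfl fun k _ => hfam (S k), prod_const_one, hfam, one_pow]

/-- Transport of a cover family along equalities of block and event. [this work] -/
theorem covFam_congr {a a' : Finset ι} {A A' : Set (Set ι)} {𝒯 : Finset (Finset ι)} (ha : a = a') (hA : A = A')
    (h : CovFam p a A 𝒯) : CovFam p a' A' 𝒯 := by subst ha; subst hA; exact h

/-- **Principal filters** `{g ⊆ ω}` have a cover family (positive probabilities on `g`). [this work] -/
theorem covFam_principal (g : Finset ι) (hp : ∀ e ∈ g, 0 < (p e : ℝ)) :
    ∃ 𝒯, CovFam p g {ω | (↑g : Set ι) ⊆ ω} 𝒯 := by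
  induction g using Finset.induction_on with
  | empty => exact ⟨∅, covFam_univ p fun ω => by simp⟩
  | @insert e g he ih =>
    obtain ⟨𝒯, h𝒯⟩ := ih fun x hx => hp x (mem_insert_of_mem hx)
    have hleaf := covFam_leaf p (hp e (mem_insert_self e g))
    have hd₁ : DeterminedBy {ω : Set ι | e ∈ ω} (↑({e} : Finset ι) : Set ι) := by
      -- (this is `AdditiveGluingVar975.v975_det_mem`; inlined to keep the import closure small)
      rw [determinedBy_iff]
      intro ω ω' h
      have h1 : e ∈ ω ∩ (↑({e} : Finset ι) : Set ι) ↔ e ∈ ω' ∩ (↑({e} : Finset ι) : Set ι) := by rw [h]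
      simpa using h1
    have hd₂ : DeterminedBy {ω : Set ι | (↑g : Set ι) ⊆ ω} (↑g : Set ι) := ROF.determinedBy_toSet (ROF.leaf g)
    refine ⟨_, covFam_congr p ?_ ?_ (covFam_and p (disjoint_singleton_left.2 he) hd₁ hd₂ hleaf h𝒯)⟩
    · rw [insert_eq]
    · ext ω
      simp only [Set.mem_inter_iff, Set.mem_setOf_eq, coe_insert, Set.insert_subset_iff]

/-- **Clauses** `{ω meets C}` (`C` nonempty) have a cover family (positive probabilities on `C`). [this work] -/
theorem covFam_clause (C : Finset ι) (hC : C.Nonempty) (hp : ∀ e ∈ C, 0 < (p e : ℝ)) :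
    ∃ 𝒯, CovFam p C {ω | ∃ e ∈ C, e ∈ ω} 𝒯 := by
  induction C using Finset.induction_on with
  | empty => exact absurd hC (by simp)
  | @insert e C he ih =>
    have hleaf := covFam_leaf p (hp e (mem_insert_self e C))
    have hd₁ : DeterminedBy {ω : Set ι | e ∈ ω} (↑({e} : Finset ι) : Set ι) := by
      -- (this is `AdditiveGluingVar975.v975_det_mem`; inlined to keep the import closure small)
      rw [determinedBy_iff]
      intro ω ω' h
      have h1 : e ∈ ω ∩ (↑({e} : Finset ι) : Set ι) ↔ e ∈ ω' ∩ (↑({e} : Finset ι) : Set ι) := by rw [h]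
      simpa using h1
    rcases C.eq_empty_or_nonempty with hCe | hCne
    · subst hCe
      refine ⟨{{e}}, covFam_congr p (by simp) ?_ hleaf⟩
      ext ω; simp
    · obtain ⟨𝒯, h𝒯⟩ := ih hCne fun x hx => hp x (mem_insert_of_mem hx)
      have hd₂ : DeterminedBy {ω : Set ι | ∃ x ∈ C, x ∈ ω} (↑C : Set ι) := by
        have h := SafeCalc.determinedBy_clauseCore ({C} : Finset (Finset ι))
        have h1 : SafeCalc.clauseCore ({C} : Finset (Finset ι)) = {ω : Set ι | ∃ x ∈ C, x ∈ ω} := by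
          ext ω; simp [SafeCalc.clauseCore]
        have h2 : (({C} : Finset (Finset ι)).biUnion id) = C := by simp
        rw [h1, h2] at h; exact h
      refine ⟨_, covFam_congr p ?_ ?_ (covFam_or p (disjoint_singleton_left.2 he) hd₁ hd₂ hleaf h𝒯)⟩
      · rw [insert_eq]
      · ext ω
        simp only [Set.mem_union, Set.mem_setOf_eq, exists_mem_insert]

/-- **Disjoint-clause CNFs** (`clauseCore 𝒞`, clauses pairwise disjoint and nonempty) have a cover family. [this work] -/
theorem covFam_cnf (𝒞 : Finset (Finset ι)) (h𝒞 : ∀ C ∈ 𝒞, ∀ D ∈ 𝒞, C ≠ D → Disjoint C D) (hne : ∀ C ∈ 𝒞, C.Nonempty)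
    (hp : ∀ e ∈ 𝒞.biUnion id, 0 < (p e : ℝ)) : ∃ 𝒯, CovFam p (𝒞.biUnion id) (clauseCore 𝒞) 𝒯 := by
  induction 𝒞 using Finset.induction_on with
  | empty => exact ⟨∅, covFam_congr p (by simp) rfl (covFam_univ p fun ω C hC => absurd hC (notMem_empty C))⟩
  | @insert C 𝒞 hC ih =>
    obtain ⟨𝒯, h𝒯⟩ := ih (fun C' hC' D hD hne' => h𝒞 C' (mem_insert_of_mem hC') D (mem_insert_of_mem hD) hne')
      (fun C' hC' => hne C' (mem_insert_of_mem hC')) (fun e he => hp e (by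
        rw [mem_biUnion] at he ⊢; obtain ⟨D, hD, heD⟩ := he; exact ⟨D, mem_insert_of_mem hD, heD⟩))
    obtain ⟨𝒮, h𝒮⟩ := covFam_clause p C (hne C (mem_insert_self C 𝒞)) fun e he => hp e (by
      rw [mem_biUnion]; exact ⟨C, mem_insert_self C 𝒞, he⟩)
    have hdisj : Disjoint C (𝒞.biUnion id) := by
      rw [Finset.disjoint_biUnion_right]
      intro D hD
      exact h𝒞 C (mem_insert_self C 𝒞) D (mem_insert_of_mem hD) (fun h => hC (h ▸ hD))
    have hd₁ : DeterminedBy {ω : Set ι | ∃ x ∈ C, x ∈ ω} (↑C : Set ι) := by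
      have h := SafeCalc.determinedBy_clauseCore ({C} : Finset (Finset ι))
      have h1 : SafeCalc.clauseCore ({C} : Finset (Finset ι)) = {ω : Set ι | ∃ x ∈ C, x ∈ ω} := by
        ext ω; simp [SafeCalc.clauseCore]
      have h2 : (({C} : Finset (Finset ι)).biUnion id) = C := by simp
      rw [h1, h2] at h; exact h
    refine ⟨_, covFam_congr p ?_ ?_ (covFam_and p hdisj hd₁ (determinedBy_clauseCore 𝒞) h𝒮 h𝒯)⟩
    · rw [Finset.biUnion_insert]; rfl
    · ext ω
      simp only [clauseCore, Set.mem_inter_iff, Set.mem_setOf_eq, forall_mem_insert]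

end SafeCalc

namespace ROF

/-- **Every well-formed read-once formula has a cover family on its support** (positive probabilities on the support). [this work] -/
theorem exists_covFam : ∀ F : ROF ι, F.WF → (∀ e ∈ F.supp, 0 < (p e : ℝ)) → ∃ 𝒯, SafeCalc.CovFam p F.supp F.toSet 𝒯
  | leaf g, _, hp => SafeCalc.covFam_principal p g hp
  | cnf 𝒞, hW, hp => SafeCalc.covFam_cnf p 𝒞 hW.1 hW.2 hp
  | .and F G, hW, hp => by
    obtain ⟨𝒯, h𝒯⟩ := exists_covFam F hW.1 fun e he => hp e (Finset.mem_union_left _ he)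
    obtain ⟨𝒮, h𝒮⟩ := exists_covFam G hW.2.1 fun e he => hp e (Finset.mem_union_right _ he)
    exact ⟨_, SafeCalc.covFam_and p hW.2.2 (determinedBy_toSet F) (determinedBy_toSet G) h𝒯 h𝒮⟩
  | .or F G, hW, hp => by
    obtain ⟨𝒯, h𝒯⟩ := exists_covFam F hW.1 fun e he => hp e (Finset.mem_union_left _ he)
    obtain ⟨𝒮, h𝒮⟩ := exists_covFam G hW.2.1 fun e he => hp e (Finset.mem_union_right _ he)
    exact ⟨_, SafeCalc.covFam_or p hW.2.2 (determinedBy_toSet F) (determinedBy_toSet G) h𝒯 h𝒮⟩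

/-- **EVERY WELL-FORMED READ-ONCE CORE IS GRADEDLY SAFE on its support**, for every product measure with positive probabilities on the
support ((GS-RO) of gen 35; THEOREMS 1–2 of the memo). [this work] -/
theorem gsafe_of_wf [Fintype ι] (F : ROF ι) (hW : F.WF) (hp : ∀ e ∈ F.supp, 0 < (p e : ℝ)) :
    SafeCalc.GSafe p F.supp F.toSet := by
  obtain ⟨𝒯, h𝒯⟩ := exists_covFam p F hW hp
  exact SafeCalc.gsafe_of_covFam p (determinedBy_toSet F) (isUpperSet_toSet F) h𝒯

/-- **EVERY WELL-FORMED READ-ONCE CORE IS SAFE** ((RO) of gen 34): `∏ μ(V i) ≤ μ(A)^(n−1)` for every family of up-sets meeting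
pairwise inside it, for every product measure with positive probabilities on the support. [this work] -/
theorem safe_of_wf [Fintype ι] (F : ROF ι) (hW : F.WF) (hp : ∀ e ∈ F.supp, 0 < (p e : ℝ)) : SafeCalc.Safe p F.toSet :=
  SafeCalc.safe_of_gsafe p F.supp (determinedBy_toSet F) (isUpperSet_toSet F) (gsafe_of_wf p F hW hp)

/-! ## The law-level rows for sunflowers with an arbitrary read-once core -/

section Rows

variable [Fintype ι] {F : ROF ι} {E₁ E₂ E₃ : Set (Set ι)}

/-- **Lemma A** for a three-petal sunflower of up-sets whose core is ANY read-once up-set: `μ(E₁) μ(E₂) μ(E₃) ≤ μ(A)²`. [this work] -/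
theorem lemmaA_of_wf (hW : F.WF) (hp : ∀ e ∈ F.supp, 0 < (p e : ℝ)) (h₁ : IsUpperSet E₁) (h₂ : IsUpperSet E₂)
    (h₃ : IsUpperSet E₃) (h12 : E₁ ∩ E₂ = F.toSet) (h13 : E₁ ∩ E₃ = F.toSet) (h23 : E₂ ∩ E₃ = F.toSet) :
    (prodBernoulli p).real E₁ * (prodBernoulli p).real E₂ * (prodBernoulli p).real E₃ ≤ ((prodBernoulli p).real F.toSet) ^ 2 :=
  SafeCalc.lemmaA_of_safe p (safe_of_wf p F hW hp) h₁ h₂ h₃ h12 h13 h23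

/-- **(C1-law)** `e₃ ≤ max(a,b)·(ab − e₂)` for every three-petal sunflower of up-sets with ANY read-once core. [this work] -/
theorem e3_le_max_mul_AG_of_wf (hW : F.WF) (hp : ∀ e ∈ F.supp, 0 < (p e : ℝ)) (h₁ : IsUpperSet E₁)
    (h₂ : IsUpperSet E₂) (h₃ : IsUpperSet E₃) (h12 : E₁ ∩ E₂ = F.toSet) (h13 : E₁ ∩ E₃ = F.toSet) (h23 : E₂ ∩ E₃ = F.toSet) :
    (prodBernoulli p).real (E₁ \ F.toSet) * (prodBernoulli p).real (E₂ \ F.toSet) * (prodBernoulli p).real (E₃ \ F.toSet) ≤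
      max ((prodBernoulli p).real F.toSet) ((prodBernoulli p).real (E₁ ∪ E₂ ∪ E₃)ᶜ) *
        ((prodBernoulli p).real F.toSet * (prodBernoulli p).real (E₁ ∪ E₂ ∪ E₃)ᶜ -
          ((prodBernoulli p).real (E₁ \ F.toSet) * (prodBernoulli p).real (E₂ \ F.toSet) +
            (prodBernoulli p).real (E₁ \ F.toSet) * (prodBernoulli p).real (E₃ \ F.toSet) +
            (prodBernoulli p).real (E₂ \ F.toSet) * (prodBernoulli p).real (E₃ \ F.toSet))) :=
  SafeCalc.e3_le_max_mul_AG_of_safe p (safe_of_wf p F hW hp) h₁ h₂ h₃ h12 h13 h23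

/-- **The `H`-row** `(a + b)(ab − e₂) ≥ e₃` for every three-petal sunflower of up-sets with ANY read-once core. [this work] -/
theorem lawH_nonneg_of_wf (hW : F.WF) (hp : ∀ e ∈ F.supp, 0 < (p e : ℝ)) (h₁ : IsUpperSet E₁)
    (h₂ : IsUpperSet E₂) (h₃ : IsUpperSet E₃) (h12 : E₁ ∩ E₂ = F.toSet) (h13 : E₁ ∩ E₃ = F.toSet) (h23 : E₂ ∩ E₃ = F.toSet) :
    0 ≤ ((prodBernoulli p).real F.toSet + (prodBernoulli p).real (E₁ ∪ E₂ ∪ E₃)ᶜ) *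
        ((prodBernoulli p).real F.toSet * (prodBernoulli p).real (E₁ ∪ E₂ ∪ E₃)ᶜ -
          ((prodBernoulli p).real (E₁ \ F.toSet) * (prodBernoulli p).real (E₂ \ F.toSet) +
            (prodBernoulli p).real (E₁ \ F.toSet) * (prodBernoulli p).real (E₃ \ F.toSet) +
            (prodBernoulli p).real (E₂ \ F.toSet) * (prodBernoulli p).real (E₃ \ F.toSet))) -
      (prodBernoulli p).real (E₁ \ F.toSet) * (prodBernoulli p).real (E₂ \ F.toSet) * (prodBernoulli p).real (E₃ \ F.toSet) :=
  SafeCalc.lawH_nonneg_of_safe p (safe_of_wf p F hW hp) h₁ h₂ h₃ h12 h13 h23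

/-- **Kahn's Conjecture 5 / Sahi `E₃ ≥ 0` for the complements** of a three-petal sunflower of up-sets with ANY read-once core. [this work] -/
theorem sahiE3_compl_nonneg_of_wf (hW : F.WF) (hp : ∀ e ∈ F.supp, 0 < (p e : ℝ)) (h₁ : IsUpperSet E₁)
    (h₂ : IsUpperSet E₂) (h₃ : IsUpperSet E₃) (h12 : E₁ ∩ E₂ = F.toSet) (h13 : E₁ ∩ E₃ = F.toSet) (h23 : E₂ ∩ E₃ = F.toSet) :
    0 ≤ sahiE3 (prodBernoulli p) E₁ᶜ E₂ᶜ E₃ᶜ :=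
  SafeCalc.sahiE3_compl_nonneg_of_safe p (safe_of_wf p F hW hp) h₁ h₂ h₃ h12 h13 h23

end Rows

/-! ## The smallest instances left open by gens 34–35 -/

section Examples

/-- `T = x₇ ∧ (x₁(x₂ ∨ x₃) ∨ x₄(x₅ ∨ x₆))` as a read-once formula on `Fin 8`. [this work] -/
def exampleT : ROF (Fin 8) :=
  .and (leaf {7}) (.or (.and (leaf {1}) (.or (leaf {2}) (leaf {3}))) (.and (leaf {4}) (.or (leaf {5}) (leaf {6}))))

/-- `exampleT` is well formed. [this work] -/
theorem wf_exampleT : exampleT.WF := by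
  simp only [exampleT, WF, supp]
  decide

/-- **`T = x₇ ∧ (x₁(x₂ ∨ x₃) ∨ x₄(x₅ ∨ x₆))` is gradedly safe** (the smallest read-once core outside the classes of gens 34–35),
for every product measure with positive probabilities on its seven variables. [this work] -/
theorem gsafe_T (q : Fin 8 → unitInterval) (hq : ∀ e ∈ exampleT.supp, 0 < (q e : ℝ)) :
    SafeCalc.GSafe q exampleT.supp exampleT.toSet :=
  gsafe_of_wf q exampleT wf_exampleT hq

/-- The disjoint self-disjunction `T ∨ T′` on `Fin 16` (14 leaves), the smallest read-once core whose SAFETY was open. [this work] -/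
def exampleTT : ROF (Fin 16) :=
  .or (.and (leaf {7}) (.or (.and (leaf {1}) (.or (leaf {2}) (leaf {3}))) (.and (leaf {4}) (.or (leaf {5}) (leaf {6})))))
    (.and (leaf {15}) (.or (.and (leaf {9}) (.or (leaf {10}) (leaf {11}))) (.and (leaf {12}) (.or (leaf {13}) (leaf {14})))))

/-- `exampleTT` is well formed. [this work] -/
theorem wf_exampleTT : exampleTT.WF := by
  simp only [exampleTT, WF, supp]
  decide

/-- **`T ∨ T′` is safe** (indeed gradedly safe), for every product measure with positive probabilities on its variables. [this work] -/
theorem safe_TT (q : Fin 16 → unitInterval) (hq : ∀ e ∈ exampleTT.supp, 0 < (q e : ℝ)) :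
    SafeCalc.Safe q exampleTT.toSet :=
  safe_of_wf q exampleTT wf_exampleTT hq

end Examples

end ROF

end Summit.CriticalPhenomena.PercolationContinuityZ3.Theorems.SunflowerPartition
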